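import Mathlib.Analysis.Calculus.Deriv.Inv
import Summits.KontsevichZagierPeriods.KontsevichZagierPeriods.Theorems.SoloBlindZetaTwoCharts
import HarnessLib

/-!
# Kontsevich–Zagier's `ζ(2) = π²/6` inside the three rules, Ib: the wedge chart

The third `ℚ`-rational chart of the move-theoretic proof of `ζ(2) = π²/6` (see
`SoloBlindZetaTwoCharts` for the setting): `Ψ(x,y) = (y/x, (1+y²)/(1+x²))` maps the open wedge
`W = {0 < y < x}` bijectively onto the parabolic region `U = {0 < u < 1, u² < v < 1}` (inverse
`x = √((1-v)/(v-u²))`, `y = ux`), with `|det DΨ| = 2(x²-y²)/(x²(1+x²)²)`, and pulls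
`du dv/(2(1-u²)v)` back to `dx dy/((1+x²)(1+y²))` (`wedge_pullback`).  This is the step that
replaces Calabi's trigonometric substitution in Kontsevich–Zagier's sketch (*Periods*, §1.2) by a
rational one, so that it is literally an instance of their rule (2) with algebraic data.
-/

noncomputable section

namespace Summit.KontsevichZagierPeriods.KontsevichZagierPeriods.Theorems

open Set MeasureTheory
open Literature.ModelTheory.ExponentialFields (IsSemialgebraic)
open Literature.NumberTheory.Transcendental
open Literature.NumberTheory.Transcendental.KZ

namespace SoloBlind

/-! ## Chart 3: `(x, y) ↦ (y/x, (1+y²)/(1+x²))` from the wedge onto the parabolic region -/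

/-- The pull-back identity of the wedge chart: on `W`,
`1/((1+x²)(1+y²)) = 1/(2(1-u²)v) · |J|` with `(u,v) = (y/x, (1+y²)/(1+x²))` and
`|J| = 2(x²-y²)/(x²(1+x²)²)`. -/
theorem wedge_pullback {x y : ℝ} (hy : 0 < y) (hyx : y < x) :
    1 / ((1 + x ^ 2) * (1 + y ^ 2)) =
      1 / (2 * (1 - (y / x) ^ 2) * ((1 + y ^ 2) / (1 + x ^ 2))) *
        (2 * (x ^ 2 - y ^ 2) / (x ^ 2 * (1 + x ^ 2) ^ 2)) := by
  have hx : 0 < x := hy.trans hyx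
  have hx2 : (0:ℝ) < 1 + x ^ 2 := by positivity
  have hy2 : (0:ℝ) < 1 + y ^ 2 := by positivity
  have hxy : 0 < x ^ 2 - y ^ 2 := by nlinarith
  have hq : 1 - (y / x) ^ 2 = (x ^ 2 - y ^ 2) / x ^ 2 := by
    field_simp
  rw [hq]
  field_simp

/-- **The wedge chart** `Ψ(x,y) = (y/x, (1+y²)/(1+x²))`: a `ℚ`-rational map of the open wedge
`W = {0 < y < x}` ONTO `U = {0 < u < 1, u² < v < 1}` (inverse `x = √((1-v)/(v-u²))`, `y = ux`),
injective, with `|det DΨ| = 2(x²-y²)/(x²(1+x²)²)`. -/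
theorem exists_wedgeChart :
    ∃ (Ψ : (Fin 2 → ℝ) → (Fin 2 → ℝ)) (Ψ' : (Fin 2 → ℝ) → (Fin 2 → ℝ) →L[ℝ] (Fin 2 → ℝ)),
      (∀ z, Ψ z 0 = z 1 / z 0) ∧ (∀ z, Ψ z 1 = (1 + z 1 ^ 2) / (1 + z 0 ^ 2)) ∧
      IsSemialgebraicMapOn ℚ kzWedge Ψ ∧ (∀ z ∈ kzWedge, HasFDerivAt Ψ (Ψ' z) z) ∧
      InjOn Ψ kzWedge ∧ Ψ '' kzWedge = kzParabolic ∧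
      (∀ z ∈ kzWedge, |(Ψ' z).det| = 2 * (z 0 ^ 2 - z 1 ^ 2) / (z 0 ^ 2 * (1 + z 0 ^ 2) ^ 2)) := by
  set Ψ : (Fin 2 → ℝ) → (Fin 2 → ℝ) := fun z => ![z 1 / z 0, (1 + z 1 ^ 2) / (1 + z 0 ^ 2)]
    with hΨ
  set Ψ' : (Fin 2 → ℝ) → (Fin 2 → ℝ) →L[ℝ] (Fin 2 → ℝ) :=
    fun z => LinearMap.toContinuousLinearMap (Matrix.toLin'
      !![-(z 1) / z 0 ^ 2, 1 / z 0;
         -(2 * z 0 * (1 + z 1 ^ 2)) / (1 + z 0 ^ 2) ^ 2, 2 * z 1 / (1 + z 0 ^ 2)]) with hΨ'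
  have hΨ0 : ∀ z, Ψ z 0 = z 1 / z 0 := fun z => rfl
  have hΨ1 : ∀ z, Ψ z 1 = (1 + z 1 ^ 2) / (1 + z 0 ^ 2) := fun z => rfl
  have hΨ'0 : ∀ z v : Fin 2 → ℝ, Ψ' z v 0 = -(z 1) / z 0 ^ 2 * v 0 + 1 / z 0 * v 1 := by
    intro z v
    change Matrix.toLin' !![-(z 1) / z 0 ^ 2, 1 / z 0;
      -(2 * z 0 * (1 + z 1 ^ 2)) / (1 + z 0 ^ 2) ^ 2, 2 * z 1 / (1 + z 0 ^ 2)] v 0 = _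
    rw [Matrix.toLin'_apply]
    simp [Matrix.mulVec, dotProduct, Fin.sum_univ_two]
  have hΨ'1 : ∀ z v : Fin 2 → ℝ, Ψ' z v 1 =
      -(2 * z 0 * (1 + z 1 ^ 2)) / (1 + z 0 ^ 2) ^ 2 * v 0 + 2 * z 1 / (1 + z 0 ^ 2) * v 1 := by
    intro z v
    change Matrix.toLin' !![-(z 1) / z 0 ^ 2, 1 / z 0;
      -(2 * z 0 * (1 + z 1 ^ 2)) / (1 + z 0 ^ 2) ^ 2, 2 * z 1 / (1 + z 0 ^ 2)] v 1 = _
    rw [Matrix.toLin'_apply]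
    simp [Matrix.mulVec, dotProduct, Fin.sum_univ_two]
  have hdet : ∀ z : Fin 2 → ℝ, z 0 ≠ 0 →
      (Ψ' z).det = 2 * (z 0 ^ 2 - z 1 ^ 2) / (z 0 ^ 2 * (1 + z 0 ^ 2) ^ 2) := by
    intro z hz0
    have h1 : (1 + z 0 ^ 2) ≠ 0 := by positivity
    change LinearMap.det (Matrix.toLin' !![-(z 1) / z 0 ^ 2, 1 / z 0;
      -(2 * z 0 * (1 + z 1 ^ 2)) / (1 + z 0 ^ 2) ^ 2, 2 * z 1 / (1 + z 0 ^ 2)]) = _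
    rw [LinearMap.det_toLin', Matrix.det_fin_two]
    simp only [Matrix.of_apply, Matrix.cons_val', Matrix.cons_val_zero, Matrix.cons_val_one,
      Matrix.cons_val_fin_one, Matrix.empty_val']
    field_simp
    ring
  have hderiv : ∀ z : Fin 2 → ℝ, 0 < z 0 → HasFDerivAt Ψ (Ψ' z) z := by
    intro z hz0
    have hz0' : z 0 ≠ 0 := hz0.ne'
    have hq0 : (1 + z 0 * z 0) ≠ 0 := by positivity
    have h0 : HasFDerivAt (fun y : Fin 2 → ℝ => y 0)
        (ContinuousLinearMap.proj (R := ℝ) (φ := fun _ : Fin 2 => ℝ) 0) z := hasFDerivAt_apply 0 z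
    have h1 : HasFDerivAt (fun y : Fin 2 → ℝ => y 1)
        (ContinuousLinearMap.proj (R := ℝ) (φ := fun _ : Fin 2 => ℝ) 1) z := hasFDerivAt_apply 1 z
    have hinv0 : HasFDerivAt (fun y : Fin 2 → ℝ => (y 0)⁻¹)
        ((ContinuousLinearMap.toSpanSingleton ℝ (-(z 0 ^ 2)⁻¹)).comp
          (ContinuousLinearMap.proj (R := ℝ) (φ := fun _ : Fin 2 => ℝ) 0)) z :=
      (hasFDerivAt_inv hz0').comp z h0
    have hsq0 : HasFDerivAt (fun y : Fin 2 → ℝ => 1 + y 0 * y 0)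
        (z 0 • ContinuousLinearMap.proj (R := ℝ) (φ := fun _ : Fin 2 => ℝ) 0 +
          z 0 • ContinuousLinearMap.proj (R := ℝ) (φ := fun _ : Fin 2 => ℝ) 0) z :=
      (h0.mul h0).const_add 1
    have hsq1 : HasFDerivAt (fun y : Fin 2 → ℝ => 1 + y 1 * y 1)
        (z 1 • ContinuousLinearMap.proj (R := ℝ) (φ := fun _ : Fin 2 => ℝ) 1 +
          z 1 • ContinuousLinearMap.proj (R := ℝ) (φ := fun _ : Fin 2 => ℝ) 1) z :=
      (h1.mul h1).const_add 1
    have hinv1 : HasFDerivAt (fun y : Fin 2 → ℝ => (1 + y 0 * y 0)⁻¹)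
        ((ContinuousLinearMap.toSpanSingleton ℝ (-((1 + z 0 * z 0) ^ 2)⁻¹)).comp
          (z 0 • ContinuousLinearMap.proj (R := ℝ) (φ := fun _ : Fin 2 => ℝ) 0 +
            z 0 • ContinuousLinearMap.proj (R := ℝ) (φ := fun _ : Fin 2 => ℝ) 0)) z :=
      (hasFDerivAt_inv hq0).comp z hsq0
    rw [hasFDerivAt_pi']
    refine Fin.forall_fin_two.mpr ⟨?_, ?_⟩
    · have hf : (fun y : Fin 2 → ℝ => Ψ y 0) = fun y => y 1 * (y 0)⁻¹ :=
        funext fun y => by rw [hΨ0, div_eq_mul_inv]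
      rw [hf]
      refine (h1.mul hinv0).congr_fderiv (ContinuousLinearMap.ext fun v => ?_)
      simp [hΨ'0]
      ring
    · have hf : (fun y : Fin 2 → ℝ => Ψ y 1) = fun y => (1 + y 1 * y 1) * (1 + y 0 * y 0)⁻¹ :=
        funext fun y => by rw [hΨ1, div_eq_mul_inv, pow_two, pow_two]
      rw [hf]
      refine (hsq1.mul hinv1).congr_fderiv (ContinuousLinearMap.ext fun v => ?_)
      simp [hΨ'1]
      field_simp
      ring
  refine ⟨Ψ, Ψ', hΨ0, hΨ1, ?_, fun z hz => hderiv z (hz.1.trans hz.2), ?_, ?_, fun z hz => ?_⟩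
  · -- semialgebraicity: both coordinates are quotients of `ℚ`-polynomials, denominators `≠ 0`
    refine IsSemialgebraicMapOn.of_forall isSemialgebraic_kzWedge (Fin.forall_fin_two.mpr ⟨?_, ?_⟩)
    · refine (isSemialgebraicFunOn_aeval_div_aeval isSemialgebraic_kzWedge (MvPolynomial.X 1)
        (MvPolynomial.X 0) fun x hx => ?_).congr fun x _ => by simp [hΨ0]
      rw [mem_kzWedge] at hx
      simpa using (hx.1.trans hx.2).ne'
    · refine (isSemialgebraicFunOn_aeval_div_aeval isSemialgebraic_kzWedge
        (1 + MvPolynomial.X 1 ^ 2) (1 + MvPolynomial.X 0 ^ 2) fun x _ => ?_).congr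
        fun x _ => by simp [hΨ1]
      have : (0:ℝ) < 1 + x 0 ^ 2 := by positivity
      simpa using this.ne'
  · intro x hx y hy hxy
    have e0 := congrFun hxy 0
    have e1 := congrFun hxy 1
    simp only [hΨ0, hΨ1] at e0 e1
    rw [mem_kzWedge] at hx hy
    have hx0 : 0 < x 0 := hx.1.trans hx.2
    have hy0 : 0 < y 0 := hy.1.trans hy.2
    have hx2 : (0:ℝ) < 1 + x 0 ^ 2 := by positivity
    have hy2 : (0:ℝ) < 1 + y 0 ^ 2 := by positivity
    rw [div_eq_div_iff hx0.ne' hy0.ne'] at e0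
    rw [div_eq_div_iff hx2.ne' hy2.ne'] at e1
    -- `e0 : x 1 * y 0 = y 1 * x 0`, `e1 : (1 + x 1 ^ 2) * (1 + y 0 ^ 2) = (1 + y 1 ^ 2) * (1 + x 0 ^ 2)`
    have hsq : (x 1 * y 0) ^ 2 = (y 1 * x 0) ^ 2 := by rw [e0]
    have h2 : y 0 ^ 2 - y 1 ^ 2 = x 0 ^ 2 - x 1 ^ 2 := by linear_combination e1 - hsq
    have h3 : (y 0 ^ 2 - x 0 ^ 2) * (x 0 ^ 2 - x 1 ^ 2) = 0 := by
      linear_combination (x 0) ^ 2 * h2 - hsq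
    have hne : x 0 ^ 2 - x 1 ^ 2 ≠ 0 := by nlinarith [hx.1, hx.2]
    have h4 : y 0 ^ 2 - x 0 ^ 2 = 0 := by
      rcases mul_eq_zero.mp h3 with h | h
      · exact h
      · exact absurd h hne
    have h5 : (y 0 - x 0) * (y 0 + x 0) = 0 := by linear_combination h4
    have h00 : x 0 = y 0 := by
      rcases mul_eq_zero.mp h5 with h | h
      · linarith
      · linarith
    have h11 : x 1 = y 1 := by
      rw [h00] at e0
      exact mul_right_cancel₀ hy0.ne' e0
    funext i
    fin_cases i
    · exact h00
    · exact h11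
  · ext w
    constructor
    · rintro ⟨z, hz, rfl⟩
      rw [mem_kzWedge] at hz
      rw [mem_kzParabolic]
      obtain ⟨h1, h10⟩ := hz
      have h0 : 0 < z 0 := h1.trans h10
      have hq : (0:ℝ) < 1 + z 0 ^ 2 := by positivity
      simp only [hΨ0, hΨ1]
      refine ⟨div_pos h1 h0, (div_lt_one h0).mpr h10, ?_, (div_lt_one hq).mpr (by nlinarith)⟩
      rw [div_pow, div_lt_div_iff₀ (by positivity) hq]
      nlinarith
    · intro hw
      rw [mem_kzParabolic] at hw
      obtain ⟨hw0, hw01, hw2, hw1⟩ := hw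
      have hd : 0 < w 1 - w 0 ^ 2 := sub_pos.mpr hw2
      have hn : 0 < 1 - w 1 := sub_pos.mpr hw1
      set s : ℝ := Real.sqrt ((1 - w 1) / (w 1 - w 0 ^ 2)) with hs_def
      have hs : 0 < s := Real.sqrt_pos.mpr (div_pos hn hd)
      have hs2 : s ^ 2 = (1 - w 1) / (w 1 - w 0 ^ 2) := Real.sq_sqrt (div_pos hn hd).le
      refine ⟨![s, w 0 * s], ?_, ?_⟩
      · rw [mem_kzWedge]
        refine ⟨mul_pos hw0 hs, ?_⟩
        change w 0 * s < s
        nlinarith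
      · funext i
        fin_cases i
        · change w 0 * s / s = w 0
          field_simp
        · change (1 + (w 0 * s) ^ 2) / (1 + s ^ 2) = w 1
          rw [mul_pow, hs2]
          field_simp
          ring
  · rw [mem_kzWedge] at hz
    have h0 : 0 < z 0 := hz.1.trans hz.2
    rw [hdet z h0.ne']
    exact abs_of_pos (by
      have : 0 < z 0 ^ 2 - z 1 ^ 2 := by nlinarith [hz.1, hz.2]
      positivity)

end SoloBlind

end Summit.KontsevichZagierPeriods.KontsevichZagierPeriods.Theorems
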